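import Summits.ResolutionOfSingularities.ResolutionOfSingularities.Theorems.PlanarCurveTrapQPow
import HarnessLib

/-!
# PlanarCurveTrapQPow2 — decomp-res node «CurveTrap» (lens-5 g26, critic row 177 CLEARED DECIDED +1), tree file 2/7 of the node

Content VERBATIM from the decomp-res lens-5 g26 node `HOME/decomp-res-lens-5/g26/CurveTrap.lean` (pin 39d382f9;
imports the landed tree only, carries nothing);
HOME = run/shared/lean/pub/decomp-res; critic row 177 CLEARED DECIDED +1; landing orders NODE §8 / INBOX :842 —
provenance, critic text and the lens header in full in the first
file of the node, `PlanarCurveTrapQPow`.  Namespace `…Theorems.CurveTrap`; `--supports stmt-ResolutionOfSingularities-31770`.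

## This file

Continuation 2/2 of `PlanarCurveTrapQPow` (same sections of the node, cut at the 400-line cap): carries
`degree_eq_add_two`, `moveMap`, `hasSubst_moveMap`, `subst_moveMap_X_self`, `subst_moveMap_X_other`,
`exists_eq_X_mul_add_X_mul`, `exists_subst_moveMap_eq`, `constantCoeff_subst_moveMap`, `coeff_single_subst_moveMap`,
`coeff_subst_X_univ`, `constantCoeff_subst_X_univ`, `coeff_single_subst_X_univ_of_ne`, `X_pow_mul_coe_pointTransform`.

[WRITER NOTE (decomp-res writer g11): file split only (tree files ≤ 400 lines); namespace, sections, section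
variables, the `open` block and every
declaration exactly as in the lens (the node's global dupNamespace-linter line is dropped — the library sets it);
ONE deletion (gate dedup
rule, critic :842 watch-list): the node's copy `eq_single_add_single_two` is NOT re-landed — it is LITERALLY the landed
`HauserPerlega2024.finsupp_eq_single_add_single` (`PointBlowupFlagTranslatedStep`, imported; namespace opened as in
the lens), cited by name at its two uses; no instance, no notation, no include/omit added.]

(Sources: HauserPerlega2024 (characteristic-free resolution of surfaces by point blowups: Props. 3–4, the monomial
case); Hauser2010 Lectures VII–IX; CossartJannsenSaito2020 Ch. 5; Moh1987; BenitoVillamayor2014; the Hasse–Schmidt /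
point-blowup flag formalism of the tree (Literature PointBlowupFlag*).)
-/

open MvPolynomial Finset
open Literature.AlgebraicGeometry.Resolution
open Literature.AlgebraicGeometry.Resolution.Hauser2010
open Literature.AlgebraicGeometry.Resolution.HauserPerlega2024
open Literature.AlgebraicGeometry.Resolution.PointBlowup
open Literature.AlgebraicGeometry.Resolution.WeightedBlowup
open Summit.ResolutionOfSingularities.ResolutionOfSingularities.Theses
open Summit.ResolutionOfSingularities.ResolutionOfSingularities.Theorems.TightDefectClasses
open Summit.ResolutionOfSingularities.ResolutionOfSingularities.Theorems.TightDefectStrongWalks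
open Summit.ResolutionOfSingularities.ResolutionOfSingularities.Theorems.ItineraryCutClasses
open Summit.ResolutionOfSingularities.ResolutionOfSingularities.Theorems.ProximityCut
open Summit.ResolutionOfSingularities.ResolutionOfSingularities.Theorems.ExitLaw
open Summit.ResolutionOfSingularities.ResolutionOfSingularities.Theorems.PlanarCut
open Summit.ResolutionOfSingularities.ResolutionOfSingularities.Theorems.CoefficientCut
open Summit.ResolutionOfSingularities.ResolutionOfSingularities.Theorems.PlanarPort
open Summit.ResolutionOfSingularities.ResolutionOfSingularities.Theorems.SectionLift

namespace Summit.ResolutionOfSingularities.ResolutionOfSingularities.Theorems.CurveTrap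

section TwoLetters

variable {σ : Type*} [DecidableEq σ] {L : Type*} [Field L]

omit [DecidableEq σ] in
/-- [folklore] -/
theorem degree_eq_add_two {x y : σ} (hxy : x ≠ y) (hσ : ∀ l, l = x ∨ l = y) (d : σ →₀ ℕ) :
    d.degree = d x + d y := by
  conv_lhs => rw [finsupp_eq_single_add_single hxy hσ d]
  rw [map_add, Finsupp.degree_single, Finsupp.degree_single]

/-- The plateau move of the `x`-chart through the point `t` of the new exceptional line, as a substitution of
power series: `X_x ↦ X_x`, `X_y ↦ X_x·(X_y + t)` ("`F'(x,y) = x^{-q} F(x, x(y+t))`").  DEFINITION. -/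
noncomputable def moveMap (x y : σ) (t : L) : σ → MvPowerSeries σ L :=
  fun l => if l = y then MvPowerSeries.X x * (MvPowerSeries.X y + MvPowerSeries.C t) else MvPowerSeries.X l

/-- [folklore] -/
theorem hasSubst_moveMap [Finite σ] (x y : σ) (t : L) : MvPowerSeries.HasSubst (moveMap x y t) := by
  refine MvPowerSeries.hasSubst_of_constantCoeff_zero fun l => ?_
  by_cases hl : l = y
  · simp [moveMap, hl]
  · simp [moveMap, if_neg hl]

/-- [folklore] -/
theorem subst_moveMap_X_self [Finite σ] {x y : σ} (hxy : x ≠ y) (t : L) :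
    MvPowerSeries.subst (moveMap x y t) (MvPowerSeries.X x : MvPowerSeries σ L) = MvPowerSeries.X x := by
  rw [MvPowerSeries.subst_X (hasSubst_moveMap x y t)]
  simp [moveMap, hxy]

/-- [folklore] -/
theorem subst_moveMap_X_other [Finite σ] (x y : σ) (t : L) :
    MvPowerSeries.subst (moveMap x y t) (MvPowerSeries.X y : MvPowerSeries σ L) =
      MvPowerSeries.X x * (MvPowerSeries.X y + MvPowerSeries.C t) := by
  rw [MvPowerSeries.subst_X (hasSubst_moveMap x y t)]
  simp [moveMap]

/-- **Splitting off the letters**: a series without constant term is `X_x·A + X_y·B` with `A(0) = [X_x] W`,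
`B(0) = [X_y] W`. [folklore] -/
theorem exists_eq_X_mul_add_X_mul {x y : σ} (hxy : x ≠ y) (hσ : ∀ l, l = x ∨ l = y) {W : MvPowerSeries σ L}
    (hW : MvPowerSeries.constantCoeff W = 0) :
    ∃ A B : MvPowerSeries σ L, W = MvPowerSeries.X x * A + MvPowerSeries.X y * B ∧
      MvPowerSeries.constantCoeff A = MvPowerSeries.coeff (Finsupp.single x 1) W ∧
      MvPowerSeries.constantCoeff B = MvPowerSeries.coeff (Finsupp.single y 1) W := by
  classical
  let A : MvPowerSeries σ L := fun d => MvPowerSeries.coeff (d + Finsupp.single x 1) W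
  let B : MvPowerSeries σ L := fun d => if d x = 0 then MvPowerSeries.coeff (d + Finsupp.single y 1) W else 0
  have hA : ∀ d, MvPowerSeries.coeff d A = MvPowerSeries.coeff (d + Finsupp.single x 1) W := fun d => rfl
  have hB : ∀ d, MvPowerSeries.coeff d B =
      if d x = 0 then MvPowerSeries.coeff (d + Finsupp.single y 1) W else 0 := fun d => rfl
  refine ⟨A, B, ?_, ?_, ?_⟩
  · refine MvPowerSeries.ext fun d => ?_
    rw [map_add, MvPowerSeries.X, MvPowerSeries.coeff_monomial_mul, MvPowerSeries.X,
      MvPowerSeries.coeff_monomial_mul, one_mul, one_mul]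
    by_cases hdx : 1 ≤ d x
    · rw [if_pos (Finsupp.single_le_iff.mpr hdx), hA, tsub_add_cancel_of_le (Finsupp.single_le_iff.mpr hdx)]
      by_cases hdy : Finsupp.single y 1 ≤ d
      · rw [if_pos hdy, hB, if_neg, add_zero]
        rw [Finsupp.tsub_apply, Finsupp.single_apply, if_neg (Ne.symm hxy)]; omega
      · rw [if_neg hdy, add_zero]
    · push Not at hdx
      have hdx0 : d x = 0 := by omega
      rw [if_neg (fun h => by have := Finsupp.single_le_iff.mp h; omega), zero_add]
      by_cases hdy : 1 ≤ d y
      · rw [if_pos (Finsupp.single_le_iff.mpr hdy), hB, if_pos, tsub_add_cancel_of_le (Finsupp.single_le_iff.mpr hdy)]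
        rw [Finsupp.tsub_apply, Finsupp.single_apply, if_neg (Ne.symm hxy)]; omega
      · rw [if_neg (fun h => hdy (Finsupp.single_le_iff.mp h))]
        have hd0 : d = 0 := finsupp_ext_two hσ (by simpa using hdx0) (by simp; omega)
        rw [hd0]
        exact hW
  · rw [← MvPowerSeries.coeff_zero_eq_constantCoeff_apply, hA, zero_add]
  · rw [← MvPowerSeries.coeff_zero_eq_constantCoeff_apply, hB, if_pos (by simp), zero_add]

/-- **The move modulo `X_x`**: `Ψ_{x,t}(S) = S(0) + X_x·R`.  [folklore] -/
theorem exists_subst_moveMap_eq [Finite σ] {x y : σ} (hxy : x ≠ y) (hσ : ∀ l, l = x ∨ l = y) (t : L) (S : MvPowerSeries σ L) :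
    ∃ R : MvPowerSeries σ L, MvPowerSeries.subst (moveMap x y t) S =
      MvPowerSeries.C (MvPowerSeries.constantCoeff S) + MvPowerSeries.X x * R := by
  have ha := hasSubst_moveMap x y t
  set S₁ := S - MvPowerSeries.C (MvPowerSeries.constantCoeff S) with hS₁
  have hS₁0 : MvPowerSeries.constantCoeff S₁ = 0 := by simp [hS₁]
  obtain ⟨A, B, hAB, -, -⟩ := exists_eq_X_mul_add_X_mul hxy hσ hS₁0
  refine ⟨MvPowerSeries.subst (moveMap x y t) A +
    (MvPowerSeries.X y + MvPowerSeries.C t) * MvPowerSeries.subst (moveMap x y t) B, ?_⟩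
  have hS : S = MvPowerSeries.C (MvPowerSeries.constantCoeff S) + S₁ := by rw [hS₁]; ring
  have key : MvPowerSeries.subst (moveMap x y t) S₁ = MvPowerSeries.X x * (MvPowerSeries.subst (moveMap x y t) A +
      (MvPowerSeries.X y + MvPowerSeries.C t) * MvPowerSeries.subst (moveMap x y t) B) := by
    rw [hAB, ← MvPowerSeries.coe_substAlgHom ha, map_add, map_mul, map_mul, MvPowerSeries.coe_substAlgHom ha,
      subst_moveMap_X_self hxy, subst_moveMap_X_other]
    ring
  conv_lhs => rw [hS]
  rw [← MvPowerSeries.coe_substAlgHom ha, map_add, MvPowerSeries.coe_substAlgHom ha, MvPowerSeries.subst_C, key]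

/-- The move keeps constant terms. [folklore] -/
theorem constantCoeff_subst_moveMap [Finite σ] {x y : σ} (hxy : x ≠ y) (hσ : ∀ l, l = x ∨ l = y) (t : L)
    (S : MvPowerSeries σ L) :
    MvPowerSeries.constantCoeff (MvPowerSeries.subst (moveMap x y t) S) = MvPowerSeries.constantCoeff S := by
  obtain ⟨R, hR⟩ := exists_subst_moveMap_eq hxy hσ t S
  rw [hR]
  simp

/-- The move kills the bare `X_y`-coefficient. [folklore] -/
theorem coeff_single_subst_moveMap [Finite σ] {x y : σ} (hxy : x ≠ y) (hσ : ∀ l, l = x ∨ l = y) (t : L)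
    (S : MvPowerSeries σ L) :
    MvPowerSeries.coeff (Finsupp.single y 1) (MvPowerSeries.subst (moveMap x y t) S) = 0 := by
  classical
  obtain ⟨R, hR⟩ := exists_subst_moveMap_eq hxy hσ t S
  rw [hR, map_add, MvPowerSeries.coeff_C, if_neg (Finsupp.single_ne_zero.mpr one_ne_zero), zero_add,
    MvPowerSeries.X, MvPowerSeries.coeff_monomial_mul, if_neg]
  intro h
  have := (Finsupp.single_le_iff.mp h)
  rw [Finsupp.single_apply, if_neg (Ne.symm hxy)] at this
  omega

/-- The univariate embedding `h(X_x)`: its coefficients. [folklore] -/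
theorem coeff_subst_X_univ (x : σ) (φ : PowerSeries L) (d : σ →₀ ℕ) :
    MvPowerSeries.coeff d (PowerSeries.subst (MvPowerSeries.X x : MvPowerSeries σ L) φ) =
      if d = Finsupp.single x (d x) then PowerSeries.coeff (d x) φ else 0 := by
  classical
  rw [PowerSeries.coeff_subst (PowerSeries.HasSubst.X x)]
  simp_rw [MvPowerSeries.coeff_X_pow]
  by_cases hd : d = Finsupp.single x (d x)
  · rw [if_pos hd]
    rw [finsum_eq_single _ (d x)]
    · rw [if_pos hd, smul_eq_mul, mul_one]
    · intro n hn
      rw [if_neg, smul_zero]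
      intro h
      apply hn
      rw [h, Finsupp.single_eq_same]
  · rw [if_neg hd]
    refine finsum_eq_zero_of_forall_eq_zero fun n => ?_
    rw [if_neg, smul_zero]
    intro h
    apply hd
    rw [h, Finsupp.single_eq_same]

omit [DecidableEq σ] in
/-- [folklore] -/
theorem constantCoeff_subst_X_univ (x : σ) {φ : PowerSeries L} (hφ : PowerSeries.constantCoeff φ = 0) :
    MvPowerSeries.constantCoeff (PowerSeries.subst (MvPowerSeries.X x : MvPowerSeries σ L) φ) = 0 :=
  PowerSeries.constantCoeff_subst_eq_zero (MvPowerSeries.constantCoeff_X x) φ hφ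

/-- [folklore] -/
theorem coeff_single_subst_X_univ_of_ne {x y : σ} (hxy : x ≠ y) (φ : PowerSeries L) (n : ℕ) (hn : n ≠ 0) :
    MvPowerSeries.coeff (Finsupp.single y n) (PowerSeries.subst (MvPowerSeries.X x : MvPowerSeries σ L) φ) = 0 := by
  classical
  rw [coeff_subst_X_univ, if_neg]
  intro h
  have := Finsupp.ext_iff.mp h y
  rw [Finsupp.single_eq_same, Finsupp.single_apply, if_neg hxy] at this
  exact hn this

/-- **The bridge**: for a polynomial all of whose monomials have degree `≥ q` and a point `b` of the `x`-chart
(`b x = 0`), `X_x^q · (pointTransform q x b s) = Ψ_{x, b y}(F)` as power series. (Sources: HauserPerlega2024, §2 p.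
774 and §4 p. 779.) -/
theorem X_pow_mul_coe_pointTransform [Fintype σ] {x y : σ} (hxy : x ≠ y) (hσ : ∀ l, l = x ∨ l = y) (q : ℕ) (b : σ → L)
    (hbx : b x = 0) (s : State σ L) (hF : ∀ d ∈ s.F.support, q ≤ d.degree) :
    (MvPowerSeries.X x : MvPowerSeries σ L) ^ q * (pointTransform q x b s : MvPowerSeries σ L) =
      MvPowerSeries.subst (moveMap x y (b y)) (s.F : MvPowerSeries σ L) := by
  classical
  unfold pointTransform
  rw [translate_chartTransform_eq_chartTransform_shear hxy hσ q b hbx]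
  rw [X_pow_mul_coe_chartTransform q x y hxy hσ]
  swap
  · intro e he
    obtain ⟨d, hd, hdeg, -, -⟩ := exists_degree_eq_of_mem_support_shear hxy hσ (b y) s.F he
    rw [hdeg]
    exact hF d hd
  rw [← substFree_smul_X_eq_coe x y (b y) s.F, substFree_eq_subst,
    MvPowerSeries.subst_comp_subst_apply (hasSubst_shift x y _ (by simp)) (hasSubst_step x y)]
  congr 1
  funext l
  by_cases hl : l = y
  · subst hl
    simp only [if_true, moveMap]
    rw [← MvPowerSeries.coe_substAlgHom (hasSubst_step x l), map_add, MvPowerSeries.coe_substAlgHom,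
      MvPowerSeries.subst_X (hasSubst_step x l), PowerSeries.subst_smul (PowerSeries.HasSubst.X x),
      PowerSeries.subst_X (PowerSeries.HasSubst.X x), ← MvPowerSeries.coe_substAlgHom (hasSubst_step x l),
      map_smul, MvPowerSeries.coe_substAlgHom, MvPowerSeries.subst_X (hasSubst_step x l)]
    simp only [if_true, if_neg hxy]
    rw [MvPowerSeries.smul_eq_C_mul]
    ring
  · simp only [if_neg hl, moveMap]
    rw [MvPowerSeries.subst_X (hasSubst_step x y), if_neg hl]

end TwoLetters

end Summit.ResolutionOfSingularities.ResolutionOfSingularities.Theorems.CurveTrap
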